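import Summits.CriticalPhenomena.PercolationContinuityZ3.Theorems.Transplant.FKDoubleFanOneSidedConeS
import Summits.CriticalPhenomena.PercolationContinuityZ3.Theorems.Transplant.FKDoubleFanOneSidedLamFloor
import HarnessLib

/-!
# Double fans `K₂ ∨ P_{m+1}`: the INPUT LEG of the closure statement `HypBaS` — two-letter product states and roof points suffice

Helper file (`--supports stmt-CriticalPhenomena-4575`), FK sub-lane `prim-bschramm-fk-3` (gen 37); builds on p205010 (kernel theorem, internal audit
signed; external expert review pending).  No named facts, no sorries; standard axioms.  Memo `bschramm/prim-bschramm-fk-3/FAR-CROSS-XII.md` §4.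

`HypBaS q` (`…OneSidedConeS`) asks `opBC y (imgA q F w) ∈ osConeS q` for all gadgets `F` and rests `w` in the explicit class `InS q`.  The image
`imgA q F w` is a linear image of the input pair `w ∧ P_a w`, hence LINEAR in the hat products of `w`: it is affine along the apex-`b` fibre
(`imgA_ufibre`) and it respects the ruling decomposition of the `Λ`-floor (**`imgA_lamfloor_ruling`**, from `uprods_lamfloor_ruling` in spirit, proved
directly).  By the `Λ`-floor ray decomposition of `…OneSidedLamFloor` (**`nonneg_of_twoletter_roof'`**, the functional form), the rest `w` may therefore be
restricted to four explicit families, all of them genuine elements of the three-apex world: the degenerate frame, the `AB∗AC`-type states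
`vecB q W y X 0 (Xy/(W−qy))`, the `AB∗BC`-type states `vecB q W y X Z y` with `y·Z₁ = X·Z`, and the roof points `roofV q κ l t w`
(**`hypBaS_of_twoletter`**).  Unlike the floor `u₀ = 0` of `…OSDEndpoints` (whose product rays `AC`, `BD` lie outside the closed cone of products of
valid rests, so that the corresponding cells are false), these endpoints are honest: the cells they produce are instances of `HypBaS` itself.
[folklore]
-/

noncomputable section

namespace Summit.CriticalPhenomena.PercolationContinuityZ3.Theorems

namespace FK

namespace ThreeApex

/-! ### The functional form of the two-letter/roof reduction -/

/-- **Two-letter states and roof points suffice (functional form).**  `Φ` affine along the fibre and affine along the rulings of the `Λ`-floor,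
`≥ 0` on the degenerate frame, the `AB∗AC`-type states, the `AB∗BC`-type states and the roof points ⟹ `Φ ≥ 0` at every vector with masses `≥ 0`,
`Λ ≥ 0` and `(U_b)` (`0 < q < 1`). [folklore] -/
theorem nonneg_of_twoletter_roof' {q : ℝ} (hq0 : 0 < q) (hq1 : q < 1) {Φ : V5 → ℝ}
    (haff : ∀ W y X Z a b c : ℝ,
      Φ (vecB q W y X Z (c * a + (1 - c) * b)) = c * Φ (vecB q W y X Z a) + (1 - c) * Φ (vecB q W y X Z b))
    (hrul : ∀ W y X Z : ℝ, 0 ≤ X → 0 < y → X < W - q * y →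
      Φ (vecB q W y X Z ((X * y + X * Z + y * Z) / (W - q * y))) =
        (1 - Z / (y * (W - q * y - X) / (X + y))) * Φ (vecB q W y X 0 (X * y / (W - q * y))) +
          Z / (y * (W - q * y - X) / (X + y)) * Φ (vecB q W y X (y * (W - q * y - X) / (X + y)) y))
    (hdeg : ∀ y u0 : ℝ, 0 ≤ u0 → u0 ≤ y → 0 ≤ Φ (vecB q (q * y) y 0 0 u0))
    (hAC : ∀ W y X : ℝ, 0 ≤ X → 0 ≤ y → q * y < W → X ≤ W - q * y → 0 ≤ Φ (vecB q W y X 0 (X * y / (W - q * y))))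
    (hBC : ∀ W y X Z : ℝ, 0 ≤ X → 0 ≤ Z → 0 ≤ y → q * y < W → Z ≤ W - q * y - X → y * (W - q * y - X - Z) = X * Z →
      0 ≤ Φ (vecB q W y X Z y))
    (hroof : ∀ κ l t w : ℝ, 0 ≤ κ → 0 < l → 0 ≤ t → 0 ≤ w → w ≤ 1 → 0 ≤ Φ (roofV q κ l t w))
    {Z : V5} (hZ : Z.Nonneg) (hΛ : 0 ≤ lam Z) (hU : UCond q (swapAB Z)) : 0 ≤ Φ Z := by
  refine nonneg_of_lamfloor hq0 hq1 haff hdeg ?_ hroof hZ hΛ hU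
  intro W y X Z uL hX hZ0 hL0 hLy hW h1 hfl
  have hl : 0 < W - q * y := by linarith
  have hy0 : 0 ≤ y := hL0.trans hLy
  have huL : uL = (X * y + X * Z + y * Z) / (W - q * y) := by rw [eq_div_iff hl.ne']; exact hfl
  rcases eq_or_lt_of_le hy0 with hy00 | hyp
  · subst hy00
    have hXZ : X * Z = 0 := by nlinarith
    have hu0 : uL = 0 := by nlinarith
    rcases mul_eq_zero.1 hXZ with hX0 | hZ00
    · subst hX0
      have := hBC W 0 0 Z le_rfl hZ0 le_rfl hW (by linarith) (by ring)
      rw [hu0]; simpa using this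
    · subst hZ00
      have := hAC W 0 X hX le_rfl hW (by linarith)
      rw [hu0]
      have e : X * (0:ℝ) / (W - q * 0) = 0 := by simp
      rw [e] at this; exact this
  · rcases eq_or_lt_of_le (show X ≤ W - q * y by linarith) with hXe | hXl
    · have hZe : Z = 0 := by linarith
      subst hZe
      have := hAC W y X hX hy0 hW hXe.le
      have e : X * y / (W - q * y) = uL := by rw [huL]; ring
      rw [e] at this; exact this
    · have htop : X * y + X * Z + y * Z ≤ y * (W - q * y) := by
        have := mul_le_mul_of_nonneg_right hLy hl.le
        rw [hfl] at this; linarith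
      obtain ⟨hθ0, hθ1⟩ := lamfloor_ruling_weight (q := q) (W := W) (by linarith) hyp hXl hZ0 htop
      rw [huL, hrul W y X Z hX hyp hXl]
      have hA := hAC W y X hX hy0 hW hXl.le
      have hB := hBC W y X (y * (W - q * y - X) / (X + y)) hX
        (div_nonneg (mul_nonneg hy0 (by linarith)) (by linarith)) hy0 hW
        (by rw [div_le_iff₀ (by linarith : (0:ℝ) < X + y)]; nlinarith)
        (by have hs : (X + y) ≠ 0 := by linarith
            field_simp
            ring)
      exact add_nonneg (mul_nonneg (sub_nonneg.2 hθ1) hA) (mul_nonneg hθ0 hB)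

/-! ### The image `imgA` in product coordinates; the rulings of the `Λ`-floor -/

/-- **The `a`-image in product coordinates**: `imgA q F w = imgAP q F (uprods w)` — the image is quadratic in the gadget `F` and LINEAR in the
hat products of the rest (`imgA_eq_imgAP`). [folklore] -/
def imgAP (q : ℝ) (F : V5) (P : P6) : Biv :=
  ⟨(F.zab * F.zac + F.z0 * F.zac + -2 * F.z0 * F.zab + -2 * F.z0 ^ 2 + q * F.z0 * F.zab + q * F.z0 ^ 2) * P.uv + (-(F.zab * F.zac) + -(F.z0 * F.zac) + F.z0 * F.zab + F.z0 ^ 2 + -(q * F.z0 * F.zab) + -(q * F.z0 ^ 2)) * P.xy + (F.z0 * F.zab + F.z0 ^ 2) * P.zv,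
    (-(F.zab * F.zbc) + F.z0 * F.z1 + F.z0 * F.zac) * P.yz + (F.zac * F.z1 + F.zac * F.zbc + F.zac ^ 2 + 2 * F.zab * F.zbc + F.zab * F.zac + -2 * F.z0 * F.z1 + -(F.z0 * F.zac) + -(q * F.zab * F.zbc) + q * F.z0 * F.z1 + q * F.z0 * F.zac) * P.uy,
    (-(F.zab * F.zac) + -(F.z0 * F.zac)) * P.yz + (F.zab * F.zac + F.z0 * F.zac) * P.uy,
    (F.zac * F.z1 + F.zac * F.zbc + F.zac ^ 2 + F.zab * F.zac + -2 * F.z0 * F.z1 + -2 * F.z0 * F.zbc + -(F.z0 * F.zac) + -2 * F.z0 * F.zab + -2 * F.z0 ^ 2 + q * F.z0 * F.z1 + q * F.z0 * F.zbc + q * F.z0 * F.zac + q * F.z0 * F.zab + q * F.z0 ^ 2) * P.uv + (F.zab * F.zbc + F.z0 * F.zbc + F.z0 * F.zab + F.z0 ^ 2 + -(q * F.zab * F.zbc) + -(q * F.z0 * F.zbc) + -(q * F.z0 * F.zab) + -(q * F.z0 ^ 2)) * P.xy + (F.z0 * F.z1 + F.z0 * F.zbc + F.z0 * F.zac + F.z0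 * F.zab + F.z0 ^ 2) * P.zv,
    (2 * F.zab * F.zbc + 2 * F.z0 * F.zbc + 2 * F.z0 * F.zab + 2 * F.z0 ^ 2 + -(q * F.zab * F.zbc) + -(q * F.z0 * F.zbc) + -(q * F.z0 * F.zab) + -(q * F.z0 ^ 2)) * P.uv + (F.zac * F.z1 + F.zac * F.zbc + F.zac ^ 2 + F.zab * F.zac + -(F.z0 * F.z1) + -(F.z0 * F.zbc) + -(F.z0 * F.zab) + -(F.z0 ^ 2) + q * F.z0 * F.z1 + q * F.z0 * F.zbc + q * F.z0 * F.zac + q * F.z0 * F.zab + q * F.z0 ^ 2) * P.xy + (-(F.zab * F.zbc) + -(F.z0 * F.zbc) + -(F.z0 * F.zab) + -(F.z0 ^ 2)) * P.zv,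
    (2 * F.z0 * F.zab + 2 * F.z0 ^ 2 + -(q * F.z0 * F.zab) + -(q * F.z0 ^ 2)) * P.uv + (F.zab * F.zac + F.z0 * F.zac + -(F.z0 * F.zab) + -(F.z0 ^ 2) + q * F.z0 * F.zab + q * F.z0 ^ 2) * P.xy + (-(F.zab * F.zac) + -(F.z0 * F.zac) + -(F.z0 * F.zab) + -(F.z0 ^ 2)) * P.zv,
    (F.zac * F.z1 + F.zac * F.zbc + F.zac ^ 2 + F.zab * F.zbc + F.zab * F.zac + -(F.z0 * F.z1) + -(q * F.zab * F.zbc) + q * F.z0 * F.z1 + q * F.z0 * F.zac) * P.xv,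
    (-(F.zac * F.z1) + -(F.zac * F.zbc) + -(F.zac ^ 2) + F.zab * F.zbc + -(F.zab * F.zac) + -(F.z0 * F.z1) + -2 * F.z0 * F.zac) * P.yz + (-2 * F.zab * F.zbc + 2 * F.z0 * F.z1 + 2 * F.z0 * F.zac + q * F.zab * F.zbc + -(q * F.z0 * F.z1) + -(q * F.z0 * F.zac)) * P.uy,
    (-2 * F.zbc * F.z1 + -2 * F.zbc ^ 2 + -2 * F.zac * F.zbc + -2 * F.zab * F.zbc + -2 * F.z0 * F.z1 + -4 * F.z0 * F.zbc + -2 * F.z0 * F.zac + -2 * F.z0 * F.zab + -2 * F.z0 ^ 2 + q * F.zbc * F.z1 + q * F.zbc ^ 2 + q * F.zac * F.zbc + q * F.zab * F.zbc + q * F.z0 * F.z1 + 2 * q * F.z0 * F.zbc + q * F.z0 * F.zac + q * F.z0 * F.zab + q * F.z0 ^ 2) * P.uv + (F.zbc * F.z1 + F.zbc ^ 2 + F.zac * F.zbc + F.zab * F.zbc + F.z0 * F.z1 + 2 * F.z0 * F.zbc + F.z0 * F.zac + F.z0 * F.zab + F.z0 ^ 2 + -(q * F.zbc * F.z1) + -(q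 * F.zbc ^ 2) + -(q * F.zac * F.zbc) + -(q * F.zab * F.zbc) + -(q * F.z0 * F.z1) + -2 * q * F.z0 * F.zbc + -(q * F.z0 * F.zac) + -(q * F.z0 * F.zab) + -(q * F.z0 ^ 2)) * P.xy + (F.zbc * F.z1 + F.zbc ^ 2 + F.zac * F.zbc + F.zab * F.zbc + F.z0 * F.z1 + 2 * F.z0 * F.zbc + F.z0 * F.zac + F.z0 * F.zab + F.z0 ^ 2) * P.zv,
    (-2 * F.z0 * F.z1 + -2 * F.z0 * F.zbc + -2 * F.z0 * F.zac + -2 * F.z0 * F.zab + -2 * F.z0 ^ 2 + q * F.z0 * F.z1 + q * F.z0 * F.zbc + q * F.z0 * F.zac + q * F.z0 * F.zab + q * F.z0 ^ 2) * P.uv + (F.zab * F.zbc + F.z0 * F.zbc + F.z0 * F.zab + F.z0 ^ 2 + -(q * F.zab * F.zbc) + -(q * F.z0 * F.zbc) + -(q * F.z0 * F.zab) + -(q * F.z0 ^ 2)) * P.xy + (F.zac * F.z1 + F.zac * F.zbc + F.zac ^ 2 + F.zab * F.zac + F.z0 * F.z1 + F.z0 * F.zbc + 2 * F.z0 * F.zac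 + F.z0 * F.zab + F.z0 ^ 2) * P.zv⟩

/-- `imgA q F w = imgAP q F (uprods w)`. [folklore] -/
theorem imgA_eq_imgAP (q : ℝ) (F w : V5) : imgA q F w = imgAP q F (uprods w) := by
  ext <;> simp only [imgA, imgAP, wedgeH, fanCombo, conv, edgeAC, detach, V5.total, hx, hy, hz, uprods] <;> ring

/-- `imgAP q F` is linear. [folklore] -/
theorem imgAP_lin (q : ℝ) (F : V5) (a b : ℝ) (P Q : P6) :
    imgAP q F (P6.add (P6.smul a P) (P6.smul b Q)) = Biv.lin3 a (imgAP q F P) b (imgAP q F Q) 0 (wedgeH F F) := by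
  ext <;> simp only [imgAP, P6.add, P6.smul, Biv.lin3, Biv.add, Biv.smul] <;> ring

/-- **`imgA` is affine along the rulings of the `Λ`-floor** (it is linear in the hat products of the rest). [folklore] -/
theorem imgA_lamfloor_ruling (q : ℝ) (F : V5) {W y X Z : ℝ} (hX : 0 ≤ X) (hy0 : 0 < y) (hX1 : X < W - q * y) :
    imgA q F (vecB q W y X Z ((X * y + X * Z + y * Z) / (W - q * y))) =
      Biv.lin3 (1 - Z / (y * (W - q * y - X) / (X + y))) (imgA q F (vecB q W y X 0 (X * y / (W - q * y))))
        (Z / (y * (W - q * y - X) / (X + y))) (imgA q F (vecB q W y X (y * (W - q * y - X) / (X + y)) y)) 0 (wedgeH F F) := by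
  rw [imgA_eq_imgAP, imgA_eq_imgAP, imgA_eq_imgAP, uprods_lamfloor_ruling hX hy0 hX1, imgAP_lin]

/-- The functional `w ↦ ⟪∧²BC_{y'} · imgA q F w, γ⟫` is affine along the rulings of the `Λ`-floor. [folklore] -/
theorem pairH_opBC_imgA_ruling (q yv : ℝ) (F : V5) (γ : Biv) {W y X Z : ℝ} (hX : 0 ≤ X) (hy0 : 0 < y) (hX1 : X < W - q * y) :
    pairH q (opBC yv (imgA q F (vecB q W y X Z ((X * y + X * Z + y * Z) / (W - q * y))))) γ =
      (1 - Z / (y * (W - q * y - X) / (X + y))) * pairH q (opBC yv (imgA q F (vecB q W y X 0 (X * y / (W - q * y))))) γ +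
        Z / (y * (W - q * y - X) / (X + y)) * pairH q (opBC yv (imgA q F (vecB q W y X (y * (W - q * y - X) / (X + y)) y))) γ := by
  rw [imgA_lamfloor_ruling q F hX hy0 hX1, opBC_lin3, pairH_lin3_left]; ring

/-! ### The reduction of the input leg -/

/-- **The input leg of `HypBaS` reduces to two-letter product states and roof points.**  If `opBC y' (imgA q F w) ∈ osConeS q` for every gadget
`F ∈ InS q`, every `y' ∈ [0,1]` and every rest `w` in the four families — degenerate frame, `AB∗AC`-type states, `AB∗BC`-type states, roof points —
then `HypBaS q` (`0 < q < 1`). [folklore] -/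
theorem hypBaS_of_twoletter {q : ℝ} (hq0 : 0 < q) (hq1 : q < 1)
    (hdeg : ∀ (F : V5) (y' y u0 : ℝ), InS q F → 0 ≤ y' → y' ≤ 1 → 0 ≤ u0 → u0 ≤ y →
      opBC y' (imgA q F (vecB q (q * y) y 0 0 u0)) ∈ osConeS q)
    (hAC : ∀ (F : V5) (y' W y X : ℝ), InS q F → 0 ≤ y' → y' ≤ 1 → 0 ≤ X → 0 ≤ y → q * y < W → X ≤ W - q * y →
      opBC y' (imgA q F (vecB q W y X 0 (X * y / (W - q * y)))) ∈ osConeS q)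
    (hBC : ∀ (F : V5) (y' W y X Z : ℝ), InS q F → 0 ≤ y' → y' ≤ 1 → 0 ≤ X → 0 ≤ Z → 0 ≤ y → q * y < W → Z ≤ W - q * y - X →
      y * (W - q * y - X - Z) = X * Z → opBC y' (imgA q F (vecB q W y X Z y)) ∈ osConeS q)
    (hroof : ∀ (F : V5) (y' κ l t w : ℝ), InS q F → 0 ≤ y' → y' ≤ 1 → 0 ≤ κ → 0 < l → 0 ≤ t → 0 ≤ w → w ≤ 1 →
      opBC y' (imgA q F (roofV q κ l t w)) ∈ osConeS q) :
    HypBaS q := by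
  intro F w y' hF hw hy0 hy1 γ hγ
  refine nonneg_of_twoletter_roof' hq0 hq1 (Φ := fun v => pairH q (opBC y' (imgA q F v)) γ) ?_ ?_ ?_ ?_ ?_ ?_
    hw.valid.nonneg hw.valid.lam hw.ub
  · intro W y X Z a b c; exact pairH_opBC_imgA_affine q y' F γ W y X Z a b c
  · intro W y X Z hX hyp hX1; exact pairH_opBC_imgA_ruling q y' F γ hX hyp hX1
  · intro y u0 hu0 hu1; exact hdeg F y' y u0 hF hy0 hy1 hu0 hu1 γ hγ
  · intro W y X hX hyy hW hXl; exact hAC F y' W y X hF hy0 hy1 hX hyy hW hXl γ hγ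
  · intro W y X Z hX hZ hyy hW hZl hrel; exact hBC F y' W y X Z hF hy0 hy1 hX hZ hyy hW hZl hrel γ hγ
  · intro κ l t w hκ hl ht hw0 hw1; exact hroof F y' κ l t w hF hy0 hy1 hκ hl ht hw0 hw1 γ hγ

/-- **Input-leg reduction for a fixed gadget and spoke weight.**  For any `F : V5` and `y'`: if `opBC y' (imgA q F w) ∈ osConeS q` for the rests `w`
in the four families (degenerate frame, `AB∗AC`-type, `AB∗BC`-type, roof points), then it holds for every rest with masses `≥ 0`, `Λ ≥ 0` and `(U_b)`
— in particular for every `w ∈ InS q` (`0 < q < 1`). [folklore] -/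
theorem opBC_imgA_mem_of_twoletter {q : ℝ} (hq0 : 0 < q) (hq1 : q < 1) {F : V5} {y' : ℝ}
    (hdeg : ∀ y u0 : ℝ, 0 ≤ u0 → u0 ≤ y → opBC y' (imgA q F (vecB q (q * y) y 0 0 u0)) ∈ osConeS q)
    (hAC : ∀ W y X : ℝ, 0 ≤ X → 0 ≤ y → q * y < W → X ≤ W - q * y → opBC y' (imgA q F (vecB q W y X 0 (X * y / (W - q * y)))) ∈ osConeS q)
    (hBC : ∀ W y X Z : ℝ, 0 ≤ X → 0 ≤ Z → 0 ≤ y → q * y < W → Z ≤ W - q * y - X → y * (W - q * y - X - Z) = X * Z →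
      opBC y' (imgA q F (vecB q W y X Z y)) ∈ osConeS q)
    (hroof : ∀ κ l t w : ℝ, 0 ≤ κ → 0 < l → 0 ≤ t → 0 ≤ w → w ≤ 1 → opBC y' (imgA q F (roofV q κ l t w)) ∈ osConeS q)
    {w : V5} (hwN : w.Nonneg) (hwΛ : 0 ≤ lam w) (hwU : UCond q (swapAB w)) : opBC y' (imgA q F w) ∈ osConeS q := by
  intro γ hγ
  refine nonneg_of_twoletter_roof' hq0 hq1 (Φ := fun v => pairH q (opBC y' (imgA q F v)) γ) ?_ ?_ ?_ ?_ ?_ ?_ hwN hwΛ hwU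
  · intro W y X Z a b c; exact pairH_opBC_imgA_affine q y' F γ W y X Z a b c
  · intro W y X Z hX hyp hX1; exact pairH_opBC_imgA_ruling q y' F γ hX hyp hX1
  · intro y u0 hu0 hu1; exact hdeg y u0 hu0 hu1 γ hγ
  · intro W y X hX hyy hW hXl; exact hAC W y X hX hyy hW hXl γ hγ
  · intro W y X Z hX hZ hyy hW hZl hrel; exact hBC W y X Z hX hZ hyy hW hZl hrel γ hγ
  · intro κ l t w₁ hκ hl ht hw0 hw1; exact hroof κ l t w₁ hκ hl ht hw0 hw1 γ hγ

end ThreeApex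

end FK

end Summit.CriticalPhenomena.PercolationContinuityZ3.Theorems
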